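import Summits.PneNP.PneNP.Theses.RootDecompLinearSpace
import Summits.PneNP.PneNP.Theorems.SoloBlindAnchor
import Literature.Computability.Complexity.DiagMachine
import Literature.Computability.Complexity.TimeConstructibleClosure
import Literature.Computability.Complexity.PaulPippengerSzemerediTrotter1983Clocks
import Literature.Computability.Complexity.NPEqUnionNTIME
import Literature.Computability.Complexity.NondeterministicProofs

/-!
# `RootDecompLinearSpace.PSubsetNTIMELinGivesS` (stmt-PneNP-31868) — the k = 1 cell of the linear-hierarchy dial is STRONG

Node N37 of the decomp-pnenp root-decomposition cell (route `route-PneNP-RootDecompLinearSpace`) files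
as a decided aside the `k = 1` cell of lens-4 g11's LINEAR-HIERARCHY DIAL: «P ⊆ NTIME(n) ⟹ P ≠ NP»,
HYPOTHESIS-FREE — else `NTIME(n²) ⊆ NP ⊆ P ⊆ NTIME(n)`, contradicting Žák's nondeterministic time
hierarchy (tree theorem `Diag.ntime_hierarchy_holds`, with `NTIME_pow_subset_NP`).  It is the BC5-grade
certificate that every FINITE cut of that dial is degenerate (the finite transfer piece is a theorem,
the finite shallow piece ≡ S).  Port of the lens-4 g11 kernel `pneNP_of_P_subset_NTIME`
(HOME/decomp-pnenp-lens-4/LinearHierarchyLift.lean sha256 a60f9a07…, writer pack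
`pSubsetNTIMELinGivesS_holds`).  0 sorry.
[cite: Zak1983] [cite: AroraBarak2009, Thm 3.2]
-/

namespace Summit.PneNP.PneNP.Theorems

open Filter Topology Asymptotics
open Literature.Computability.Complexity

/-- Nondeterministic time hierarchy instance: `NTIME(n²) ⊄ NTIME(n)` (port of the lens lemma
`not_NTIME_sq_subset_NTIME_id`, from the tree's `Diag.ntime_hierarchy_holds`).
[cite: Zak1983] [cite: AroraBarak2009, Thm 3.2] -/
private theorem linHier_not_NTIME_sq_subset_NTIME_id :
    ¬ (NTIME (fun n => n ^ 2) ⊆ NTIME (fun n => n)) := by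
  have h1 : (fun n : ℕ => ((n + 1 : ℕ) : ℝ)) =O[atTop] (fun n : ℕ => ((n : ℕ) : ℝ)) := by
    refine Asymptotics.IsBigO.of_bound 2 ?_
    filter_upwards [Filter.eventually_ge_atTop 1] with n hn
    rw [Real.norm_natCast, Real.norm_natCast]
    push_cast
    have : (1 : ℝ) ≤ n := by exact_mod_cast hn
    linarith
  have h2 : (fun n : ℕ => ((n : ℕ) : ℝ)) =o[atTop] (fun n : ℕ => ((n ^ 2 : ℕ) : ℝ)) := by
    have h := (Asymptotics.isLittleO_pow_pow_atTop_of_lt (𝕜 := ℝ) one_lt_two).comp_tendsto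
      tendsto_natCast_atTop_atTop
    refine h.congr (fun n => ?_) (fun n => ?_)
    · simp
    · simp [Nat.cast_pow]
  have hlittle : (fun n : ℕ => (((fun m : ℕ => m) (n + 1) : ℕ) : ℝ)) =o[atTop]
      (fun n : ℕ => (((fun m : ℕ => m ^ 2) n : ℕ) : ℝ)) := h1.trans_isLittleO h2
  exact Diag.ntime_hierarchy_holds (fun n => n) (fun n => n ^ 2) isTimeConstructible_id
    (isTimeConstructible_id.pow (by norm_num)) hlittle

/-- `PneNP ↔ ¬ (NP ⊆ P)` (bridge from the solo-blind anchor; port of the lens lemma). -/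
private theorem linHier_pneNP_iff_not_NP_subset_P :
    _root_.PneNP ↔ ¬ (Nondeterministic.NP ⊆ Classes.P) := by
  rw [Summit.PneNP.PneNP.Theorems.SoloBlind.pneNP_iff_P_ne_NP]
  constructor
  · intro hne hsub
    exact hne (Set.Subset.antisymm P_subset_NP_holds hsub)
  · intro hn heq
    exact hn (heq ▸ Set.Subset.refl _)

/-- The `k = 1` cell of the linear-hierarchy dial is STRONG (stmt-PneNP-31868, `PSubsetNTIMELinGivesS`),
hypothesis-free: `P ⊆ NTIME(n) → P ≠ NP` — else `NTIME(n²) ⊆ NP ⊆ P ⊆ NTIME(n)` against the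
nondeterministic time hierarchy.  Port of the lens-4 g11 kernel `pneNP_of_P_subset_NTIME`
(decomp-pnenp cell, 2026-08-30). [cite: Zak1983] -/
theorem pSubsetNTIMELinGivesS_proof :
    Summit.PneNP.PneNP.Theses.RootDecompLinearSpace.PSubsetNTIMELinGivesS := by
  unfold Summit.PneNP.PneNP.Theses.RootDecompLinearSpace.PSubsetNTIMELinGivesS
  intro hY
  exact linHier_pneNP_iff_not_NP_subset_P.2 fun hNP =>
    linHier_not_NTIME_sq_subset_NTIME_id (((NTIME_pow_subset_NP 2).trans hNP).trans hY)

end Summit.PneNP.PneNP.Theorems
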